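import Mathlib
import HarnessLib
import Summits.QuantumFields.YangMills.Theses.FradkinShenkerFlow
import Summits.QuantumFields.YangMills.Theses.EquipartitionCriticality
import Summits.QuantumFields.YangMills.Theses.DirichletWindow

/-!
# Sketch — crux-ideate stmt-QuantumFields-9443 (ClusteringToYangMills), ideator 2, round 1

First lemmas of the two idea cards, stated over existing declarations.

* Card `antipodal-docking`: `ClusteringHyp` (the crux's antecedent), `TorusConstantsUpgrade`
  (the thermal self-normalisation stub), the pure-logic docking theorem `dock` (proved), and the
  dominance `crux_of_continuumLegGivenGap` (proved; see also `SketchDominance.lean`, which imports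
  the ConvexGribovBody module and proves `crux_of_8782` against the real decl).
* A second lever (uniform heat-bath Poincaré ⇒ Aida–Stroock concentration ⇒ large-field
  suppression) was typed and then WITHDRAWN (topological freezing makes the Poincaré constant
  ≳ ξ⁵, emptying its window); its sketch is kept in `SketchWithdrawnB.lean` for the record.
-/

namespace Summit.QuantumFields.YangMills.Cruxes.ClusteringToYangMills.Sketch

open scoped BigOperators
open MeasureTheory
open Literature.MathematicalPhysics.QuantumFieldTheory
open Summit.QuantumFields.YangMills.Theses

/-- The antecedent of the crux, verbatim: volume-uniform exponential clustering in Euclidean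
time on the symmetric tori at every `β ≥ β₀(G,r)`, constants `C(A,B,β)`. -/
def ClusteringHyp : Prop :=
  ∀ (G : Type) [Group G] [TopologicalSpace G] [IsTopologicalGroup G] [CompactSpace G]
    [MeasurableSpace G] [BorelSpace G], IsCompactSimpleLieGroup G →
    ∀ (r : LatticeRep G), ∃ β₀ : ℝ, ∀ β : ℝ, β₀ ≤ β →
      (∃ m : ℝ, 0 < m ∧ ∀ A B : YMSpecies G, ∃ C : ℝ, ∀ S n : ℕ, n ≤ S →
        |latticeConnectedCorr r.ρ β (2 * S + 1) A.F B.F n| ≤ C * Real.exp (-(m * n)))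

/-- Sanity: the crux IS `ClusteringHyp → YangMills`. -/
theorem crux_unfold : FradkinShenkerFlow.ClusteringToYangMills ↔ (ClusteringHyp → YangMills) :=
  Iff.rfl

/-- **Card A, the new stub (thermal self-normalisation).** From per-`β` constants on ALL tori
to `β`-UNIFORM constants `C(A,B)` on tori of side `≥ S₀(β)` with a rate function `m(β) > 0`:
exactly hypothesis (1) of `EquipartitionCriticality.CriticalContinuumLimit`
(the `LatticeGapLargeBeta` shape). Content: OS/RP self-normalisation of the vacuum part
(complete monotonicity: `c(n+s) ≤ e^{-ms} c(n)`), log-convexity in `n` of the torus correlation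
reducing everything to the antipodal point `n = S`, and the thermal remainder
`Θ_S(S+1) = ∑_{i≥1} e^{-(E_i(S)-E_0(S))(S+1)} ≤ 1` for `S ≥ S₀(β)`. -/
def TorusConstantsUpgrade : Prop :=
  ClusteringHyp →
    ∀ (G : Type) [Group G] [TopologicalSpace G] [IsTopologicalGroup G] [CompactSpace G],
      IsCompactSimpleLieGroup G →
        letI : MeasurableSpace G := borel G
        haveI : BorelSpace G := ⟨rfl⟩
        ∀ r : LatticeRep G, ∃ (β₁ : ℝ) (m : ℝ → ℝ) (S₀ : ℝ → ℕ),
          (∀ β : ℝ, β₁ ≤ β → 0 < m β) ∧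
            ∀ A B : YMSpecies G, ∃ C : ℝ, ∀ β : ℝ, β₁ ≤ β → ∀ S n : ℕ, S₀ β ≤ S → n ≤ S →
              |latticeConnectedCorr r.ρ β (2 * S + 1) A.F B.F n| ≤ C * Real.exp (-(m β * n))

/-- **Card A, docking theorem (pure logic).** The crux follows from the canonical UV leg
`CriticalContinuumLimit` (stmt-8762), the shared criticality input `XiDiverges` (stmt-8941),
the glue `CriticalityOfXiDiverges` (stmt-12318) and the thermal upgrade. -/
theorem dock (hCCL : EquipartitionCriticality.CriticalContinuumLimit)
    (hXi : DirichletWindow.XiDiverges) (hCrit : DirichletWindow.CriticalityOfXiDiverges)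
    (hUp : TorusConstantsUpgrade) : FradkinShenkerFlow.ClusteringToYangMills := by
  intro hEC G _ _ _ _ hG
  exact hCCL G hG (hUp hEC G hG) (hCrit hXi G hG)

/-- Remark recorded for the ledger: the sibling UV leg `ConvexGribovBody.ContinuumLegGivenGap`
(stmt-8782) has a WEAKER hypothesis (tori of side `≥ S₁(β)` only), hence implies this crux by
instantiation. Stated as a `Prop` pair here (the ConvexGribovBody module is not imported). -/
def ContinuumLegGivenGapShape : Prop :=
  ∀ (G : Type) [Group G] [TopologicalSpace G] [IsTopologicalGroup G] [CompactSpace G],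
    IsCompactSimpleLieGroup G →
      letI : MeasurableSpace G := borel G
      haveI : BorelSpace G := ⟨rfl⟩
      (∀ r : LatticeRep G, ∃ β₀ : ℝ, ∀ β : ℝ, β₀ ≤ β → ∃ m : ℝ, 0 < m ∧ ∃ S₁ : ℕ,
          ∀ A B : YMSpecies G, ∃ C : ℝ, ∀ S n : ℕ, S₁ ≤ S → n ≤ S →
            |latticeConnectedCorr r.ρ β (2 * S + 1) A.F B.F n| ≤ C * Real.exp (-(m * n))) →
        ∃ (r : LatticeRep G) (sch : SpeciesScheme (YMSpecies G)) (T : OSData (YMSpecies G) 4),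
          IsYangMillsFor r sch T ∧ T.IsNontrivial r.curvature ∧ T.IsNonGaussian r.curvature ∧
            ∃ Δ > 0, T.HasMassGap Δ ∧ HasLatticeMassGap r sch Δ

theorem crux_of_continuumLegGivenGap (h : ContinuumLegGivenGapShape) :
    FradkinShenkerFlow.ClusteringToYangMills := by
  intro hEC G _ _ _ _ hG
  letI : MeasurableSpace G := borel G
  haveI : BorelSpace G := ⟨rfl⟩
  refine h G hG (fun r => ?_)
  obtain ⟨β₀, hβ₀⟩ := hEC G hG r
  refine ⟨β₀, fun β hβ => ?_⟩
  obtain ⟨m, hm, hAB⟩ := hβ₀ β hβ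
  exact ⟨m, hm, 0, fun A B => (hAB A B).imp fun C hC S n _ hn => hC S n hn⟩

end Summit.QuantumFields.YangMills.Cruxes.ClusteringToYangMills.Sketch
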